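import Mathlib.Algebra.BigOperators.Ring.Finset
import Mathlib.Algebra.BigOperators.GroupWithZero.Finset
import Mathlib.Algebra.BigOperators.Fin
import Mathlib.Algebra.Order.BigOperators.Ring.Finset
import Mathlib.Data.Finset.Powerset
import Mathlib.Data.Fintype.Pi
import Mathlib.Data.Real.Basic
import Mathlib.Tactic.FieldSimp
import Mathlib.Tactic.Linarith
import Mathlib.Tactic.Ring
import HarnessLib

/-!
# `NoHeavyLowerTail` (stmt-CriticalPhenomena-4575) — EXTREME REGROUPING of a family of independent two-port stars (algebra)

Support file (prover `prim-gen-swap` gen 7; `--supports stmt-CriticalPhenomena-4575`).  No definitions, no named facts, no sorries; Mathlib only.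

Steps (2)–(3) of the level-two observer-set theorem for two-port star sets (seat memo R3-SEATS.md §7, blueprint LEAN-BLUEPRINT-StarSet.md)
regroup the `4^m` joint attachment states of `m` independent two-port stars into the `3^m` EXTREME WORDS.  Star `i` attaches to its
first port with probability `β_i` and to its second port with probability `β_i'`, independently; a state is `t : Fin m → Bool × Bool`
and its probability is `Π_i ι_i(t_i)`, `ι_i(b, b') = (β_i | 1−β_i)·(β_i' | 1−β_i')`.  The three extremes of star `i` are the laws
"comonotone" (`k = 0`: detached, or attached to both ports with probability `θ_i = β_iβ_i'`), "glued to the first port" (`k = 1`) and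
"glued to the second port" (`k = 2`): under extreme `k` the star sits in its BASE state `(k = 1, k = 2)` with probability `1 − θ_i` and in
the state `(true, true)` with probability `θ_i`.  The per-star identity `(1−θ)ι = ν(∅)·C + ν(p)·G_p + ν(p')·G_{p'}` (prim-hp-2's extreme
expansion) says `ι_i = Σ_k a_i(k)·(law of extreme k)` with `a_i(k) = ι_i(base k)/(1−θ_i) ≥ 0` (`a_i = (0,1,0)` if `θ_i = 1`).

* `StarSet.star_extreme_decomp` — the per-star identity, for every state;
* `StarSet.extremeCoeff_nonneg` — `a_i(k) ≥ 0`;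
* `StarSet.link_pattern_expansion` — for a word `e : Fin m → Fin 3`, `Π_i (θ_i[t_i = (1,1)] + (1−θ_i)[t_i = base(e_i)]) =
  Σ_σ w(σ)·[t = t(e,σ)]`, `w(σ) = Π_{i∈σ}θ_iΠ_{i∉σ}(1−θ_i)`, `t(e,σ)_i = (1,1)` if `i ∈ σ` else `base(e_i)`;
* `StarSet.extreme_regroup` — **`Σ_t (Π_i ι_i(t_i))·F(t) = Σ_e (Π_i a_i(e_i)) · Σ_σ w(σ)·F(t(e,σ))`** for every `F`.
With `F(t)` = the honest cell of the gate set of `t` this turns the flat star expansion of `CSdiff_w(B; c)` into a nonnegative combination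
of the `3^m` word terms `Σ_σ w(σ)F(t(e,σ))`, each of which is shown nonnegative separately (glued words: relay-set rows; the comonotone
word: the nested certificate).
-/

namespace Summit.CriticalPhenomena.PercolationContinuityZ3.Theorems

open Finset
open scoped BigOperators

namespace StarSet

variable {m : ℕ}

/-- **Per-star extreme decomposition.**  For `β, β' ∈ [0,1]` and every state `τ ∈ Bool × Bool`:
`ι(τ) = Σ_{k<3} a(k)·(θ[τ = (1,1)] + (1−θ)[τ = base k])`, `θ = ββ'`, `base k = (k = 1, k = 2)`,
`a(k) = ι(base k)/(1−θ)` if `θ < 1` and `a = (0,1,0)` if `θ = 1`. [folklore] -/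
theorem star_extreme_decomp (β β' : ℝ) (hβ0 : 0 ≤ β) (hβ1 : β ≤ 1) (hβ'0 : 0 ≤ β') (hβ'1 : β' ≤ 1) (τ : Bool × Bool) :
    ((if τ.1 then β else 1 - β) * (if τ.2 then β' else 1 - β')) =
      ∑ k : Fin 3,
        (if β * β' < 1 then ((if k = 1 then β else 1 - β) * (if k = 2 then β' else 1 - β')) / (1 - β * β')
          else if k = 1 then 1 else 0) *
        ((if τ = (true, true) then β * β' else 0) + (if τ = (decide (k = 1), decide (k = 2)) then 1 - β * β' else 0)) := by
  obtain ⟨b1, b2⟩ := τ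
  rw [Fin.sum_univ_three]
  by_cases hlt : β * β' < 1
  · have hne : (1 - β * β') ≠ 0 := by linarith
    simp only [hlt, if_true]
    cases b1 <;> cases b2
    · simp
      field_simp
    · simp
      field_simp
    · simp
      field_simp
    · simp
      field_simp
      ring
  · have hge : 1 ≤ β * β' := not_lt.1 hlt
    have h1 : β = 1 := le_antisymm hβ1 (by nlinarith)
    have h2 : β' = 1 := le_antisymm hβ'1 (by nlinarith)
    subst h1; subst h2
    simp only [hlt, if_false]
    cases b1 <;> cases b2 <;> simp

/-- The extreme coefficients are nonnegative. [folklore] -/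
theorem extremeCoeff_nonneg (β β' : ℝ) (hβ0 : 0 ≤ β) (hβ1 : β ≤ 1) (hβ'0 : 0 ≤ β') (hβ'1 : β' ≤ 1) (k : Fin 3) :
    0 ≤ (if β * β' < 1 then ((if k = 1 then β else 1 - β) * (if k = 2 then β' else 1 - β')) / (1 - β * β')
      else if k = 1 then (1 : ℝ) else 0) := by
  split_ifs with h
  · exact div_nonneg (mul_nonneg hβ0 hβ'0) (by linarith)
  · exact div_nonneg (mul_nonneg hβ0 (by linarith)) (by linarith)
  · exact div_nonneg (mul_nonneg (by linarith) hβ'0) (by linarith)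
  · exact div_nonneg (mul_nonneg (by linarith) (by linarith)) (by linarith)
  · exact zero_le_one
  · exact le_refl 0

/-- **Link-pattern expansion of a word.**  For `θ : Fin m → ℝ`, a word `e : Fin m → Fin 3` and a state `t`:
`Π_i (θ_i[t_i = (1,1)] + (1−θ_i)[t_i = base(e_i)]) = Σ_σ (Π_{i∈σ}θ_i)(Π_{i∉σ}(1−θ_i))·[t = t(e,σ)]`. [folklore] -/
theorem link_pattern_expansion (θ : Fin m → ℝ) (e : Fin m → Fin 3) (t : Fin m → Bool × Bool) :
    ∏ i, ((if t i = (true, true) then θ i else 0) + (if t i = (decide (e i = 1), decide (e i = 2)) then 1 - θ i else 0)) =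
      ∑ σ ∈ (univ : Finset (Fin m)).powerset, ((∏ i ∈ σ, θ i) * ∏ i ∈ univ \ σ, (1 - θ i)) *
        (if t = (fun i => if i ∈ σ then (true, true) else (decide (e i = 1), decide (e i = 2))) then 1 else 0) := by
  rw [Finset.prod_add]
  refine Finset.sum_congr rfl fun σ _ => ?_
  rw [Finset.prod_ite_zero, Finset.prod_ite_zero]
  have hiff : t = (fun i => if i ∈ σ then (true, true) else (decide (e i = 1), decide (e i = 2))) ↔
      (∀ i ∈ σ, t i = (true, true)) ∧ (∀ i ∈ univ \ σ, t i = (decide (e i = 1), decide (e i = 2))) := by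
    constructor
    · intro h
      refine ⟨fun i hi => ?_, fun i hi => ?_⟩
      · rw [h]; simp only [hi, if_true]
      · rw [h]
        have hi' : i ∉ σ := (Finset.mem_sdiff.1 hi).2
        simp only [hi', if_false]
    · rintro ⟨h1, h2⟩
      funext i
      by_cases hi : i ∈ σ
      · simp only [hi, if_true]; exact h1 i hi
      · simp only [hi, if_false]; exact h2 i (Finset.mem_sdiff.2 ⟨Finset.mem_univ _, hi⟩)
  by_cases h1 : ∀ i ∈ σ, t i = (true, true)
  · by_cases h2 : ∀ i ∈ univ \ σ, t i = (decide (e i = 1), decide (e i = 2))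
    · rw [if_pos h1, if_pos h2, if_pos (hiff.2 ⟨h1, h2⟩), mul_one]
    · rw [if_pos h1, if_neg h2, if_neg (fun h => h2 (hiff.1 h).2), mul_zero, mul_zero]
  · rw [if_neg h1, if_neg (fun h => h1 (hiff.1 h).1), zero_mul, mul_zero]

/-- **Extreme regrouping.**  `Σ_t (Π_i ι_i(t_i))·F(t) = Σ_e (Π_i a_i(e_i)) · Σ_σ w(σ)·F(t(e,σ))` (notation of the file header),
for every real function `F` of the joint state of `m` independent two-port stars with port probabilities `β_i, β_i' ∈ [0,1]`. [folklore] -/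
theorem extreme_regroup (β β' : Fin m → ℝ) (hβ0 : ∀ i, 0 ≤ β i) (hβ1 : ∀ i, β i ≤ 1) (hβ'0 : ∀ i, 0 ≤ β' i)
    (hβ'1 : ∀ i, β' i ≤ 1) (F : (Fin m → Bool × Bool) → ℝ) :
    ∑ t : Fin m → Bool × Bool, (∏ i, ((if (t i).1 then β i else 1 - β i) * (if (t i).2 then β' i else 1 - β' i))) * F t =
      ∑ e : Fin m → Fin 3,
        (∏ i, (if β i * β' i < 1 then
            ((if e i = 1 then β i else 1 - β i) * (if e i = 2 then β' i else 1 - β' i)) / (1 - β i * β' i)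
          else if e i = 1 then 1 else 0)) *
        ∑ σ ∈ (univ : Finset (Fin m)).powerset,
          ((∏ i ∈ σ, β i * β' i) * ∏ i ∈ univ \ σ, (1 - β i * β' i)) *
            F (fun i => if i ∈ σ then (true, true) else (decide (e i = 1), decide (e i = 2))) := by
  -- abbreviations
  set a : Fin m → Fin 3 → ℝ := fun i k => if β i * β' i < 1 then
      ((if k = 1 then β i else 1 - β i) * (if k = 2 then β' i else 1 - β' i)) / (1 - β i * β' i)
    else if k = 1 then 1 else 0 with ha
  set lam : Fin m → Fin 3 → Bool × Bool → ℝ := fun i k τ =>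
    (if τ = (true, true) then β i * β' i else 0) + (if τ = (decide (k = 1), decide (k = 2)) then 1 - β i * β' i else 0)
    with hlam
  set tOf : (Fin m → Fin 3) → Finset (Fin m) → (Fin m → Bool × Bool) :=
    fun e σ i => if i ∈ σ then (true, true) else (decide (e i = 1), decide (e i = 2)) with htOf
  set wt : Finset (Fin m) → ℝ := fun σ => (∏ i ∈ σ, β i * β' i) * ∏ i ∈ univ \ σ, (1 - β i * β' i) with hwt
  -- (1) the product over the stars, expanded over the words
  have hprod : ∀ t : Fin m → Bool × Bool,
      (∏ i, ((if (t i).1 then β i else 1 - β i) * (if (t i).2 then β' i else 1 - β' i))) =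
        ∑ e : Fin m → Fin 3, (∏ i, a i (e i)) * ∏ i, lam i (e i) (t i) := by
    intro t
    have hst : ∀ i, ((if (t i).1 then β i else 1 - β i) * (if (t i).2 then β' i else 1 - β' i)) =
        ∑ k : Fin 3, a i k * lam i k (t i) := by
      intro i
      rw [star_extreme_decomp (β i) (β' i) (hβ0 i) (hβ1 i) (hβ'0 i) (hβ'1 i) (t i)]
    rw [Finset.prod_congr rfl fun i _ => hst i, Fintype.prod_sum]
    refine Finset.sum_congr rfl fun e _ => ?_
    rw [Finset.prod_mul_distrib]
  -- (2) the product of the extreme laws, expanded over the link patterns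
  have hlam_prod : ∀ (e : Fin m → Fin 3) (t : Fin m → Bool × Bool),
      ∏ i, lam i (e i) (t i) = ∑ σ ∈ (univ : Finset (Fin m)).powerset, wt σ * (if t = tOf e σ then 1 else 0) := by
    intro e t
    exact link_pattern_expansion (fun i => β i * β' i) e t
  -- (3) the inner sum over the states collapses to the link patterns
  have hinner : ∀ e : Fin m → Fin 3,
      ∑ t : Fin m → Bool × Bool, (∏ i, lam i (e i) (t i)) * F t =
        ∑ σ ∈ (univ : Finset (Fin m)).powerset, wt σ * F (tOf e σ) := by
    intro e
    calc ∑ t : Fin m → Bool × Bool, (∏ i, lam i (e i) (t i)) * F t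
        = ∑ t : Fin m → Bool × Bool, ∑ σ ∈ (univ : Finset (Fin m)).powerset,
            wt σ * ((if t = tOf e σ then 1 else 0) * F t) := by
          refine Finset.sum_congr rfl fun t _ => ?_
          rw [hlam_prod e t, Finset.sum_mul]
          refine Finset.sum_congr rfl fun σ _ => ?_
          ring
      _ = ∑ σ ∈ (univ : Finset (Fin m)).powerset, ∑ t : Fin m → Bool × Bool,
            wt σ * ((if t = tOf e σ then 1 else 0) * F t) := Finset.sum_comm
      _ = ∑ σ ∈ (univ : Finset (Fin m)).powerset, wt σ * F (tOf e σ) := by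
          refine Finset.sum_congr rfl fun σ _ => ?_
          rw [← Finset.mul_sum]
          congr 1
          have hite : ∀ t : Fin m → Bool × Bool,
              (if t = tOf e σ then (1 : ℝ) else 0) * F t = if t = tOf e σ then F t else 0 := by
            intro t
            split_ifs <;> simp
          rw [Finset.sum_congr rfl fun t _ => hite t, Fintype.sum_ite_eq']
  -- (4) assemble
  calc ∑ t : Fin m → Bool × Bool,
        (∏ i, ((if (t i).1 then β i else 1 - β i) * (if (t i).2 then β' i else 1 - β' i))) * F t
      = ∑ t : Fin m → Bool × Bool, ∑ e : Fin m → Fin 3, (∏ i, a i (e i)) * ((∏ i, lam i (e i) (t i)) * F t) := by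
        refine Finset.sum_congr rfl fun t _ => ?_
        rw [hprod t, Finset.sum_mul]
        refine Finset.sum_congr rfl fun e _ => ?_
        ring
    _ = ∑ e : Fin m → Fin 3, ∑ t : Fin m → Bool × Bool, (∏ i, a i (e i)) * ((∏ i, lam i (e i) (t i)) * F t) :=
        Finset.sum_comm
    _ = ∑ e : Fin m → Fin 3, (∏ i, a i (e i)) * ∑ σ ∈ (univ : Finset (Fin m)).powerset, wt σ * F (tOf e σ) := by
        refine Finset.sum_congr rfl fun e _ => ?_
        rw [← Finset.mul_sum, hinner e]

end StarSet

end Summit.CriticalPhenomena.PercolationContinuityZ3.Theorems
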